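import Literature.Barriers.BirchSwinnertonDyer.RankNotSumOfLocalInvariantsF5
import Literature.Barriers.BirchSwinnertonDyer.RankNotSumOfLocalInvariantsCpCpProofs
import Literature.Barriers.BirchSwinnertonDyer.RankNotSumOfLocalInvariants480a1Proofs
import HarnessLib

/-!
# Barrier (BirchSwinnertonDyer), rank mod `5`: `rk E(F₅) = 1` reduced to six quintic `2`-descents

Companion to `Literature/Barriers/BirchSwinnertonDyer/RankNotSumOfLocalInvariantsF5.lean`, which
constructs the field `F₅` of T. Dokchitser–V. Dokchitser, *A note on the Mordell–Weil rank modulo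
`n`*, J. Number Theory 131 (2011) 1833–1839 (arXiv:0910.4588), proof of Theorem 2 — "the degree 25
subfield of `ℚ(ζ₁₁, ζ₂₄₁)`", there `DokchitserDokchitser2011.F5 K` for a `2651`-st cyclotomic
extension `K/ℚ` — proves its splitting properties, and reduces the `n = 5` witness of Theorem 2
(the named fact `Literature.Barriers.BirchSwinnertonDyer.DokchitserDokchitser2011_rank_480a1_F5` of
`RankNotSumOfLocalInvariantsProofs.lean`) to its rank leaf
`Literature.Barriers.BirchSwinnertonDyer.DokchitserDokchitser2011_mordellWeilRank_480a1_F5`: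
`rk_ℤ E(F₅) = 1` for `E = 480a1 : y² = x(x+2)(x-3)`, in the source the sentence "2-descent shows that
`rk E/F₃ = rk E/F₅ = 1` […] (e.g. using Magma, over all minimal non-trivial subfields of `F_n`)"
(p. 3 of the held arXiv copy).

This file formalises that sentence for `n = 5` up to the computer descents themselves — the `n = 5`
twin of `RankNotSumOfLocalInvariantsF3Cubic.lean` (`n = 3`, four cubic subfields):
`Gal(F₅/ℚ) ≅ C₅ × C₅`, the minimal non-trivial subfields of `F₅` are its six quintic subfields
`F₅^{⟨σ⟩}` (`σ ≠ 1`), and `rk E(F₅) = 1` FOLLOWS from the `2`-descent bounds `rk E(F₅^{⟨σ⟩}) ≤ 1`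
over these quintic fields together with the rational point `(-1, 2)` of infinite order — and
conversely, so that the six quintic bounds are EQUIVALENT to the rank leaf
(`DokchitserDokchitser2011_mordellWeilRank_480a1_F5_iff_quintic`).

| source (DokchitserDokchitser2011RankModN, proof of Thm. 2, `n = 5`) | declaration | status |
|---|---|---|
| `Gal(F₅/ℚ) ≅ C₅ × C₅` (order `25`, exponent `5`) | `DokchitserDokchitser2011.F5.card_aut`, `….F5.algEquiv_pow_five` (`….pow_five_mem_galFifthPowers`) | proved |
| "minimal non-trivial subfields of `F₅`" = the quintic subfields `F₅^{⟨σ⟩}`, `σ ≠ 1` | `….F5.mem_fixedField_zpowers_of_apply_eq`, `….F5.finrank_fixedField_zpowers` (`[F₅^{⟨σ⟩} : ℚ] = 5`) | proved (Mathlib `IntermediateField.fixedField (Subgroup.zpowers σ)`; no new definition) |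
| `480a1` has a rational point of infinite order (`rk E(ℚ) ≥ 1`) | `curve480a1.exists_nsmul_ne_zero` (`…480a1Proofs.lean`) | proved |
| "2-descent […] over all minimal non-trivial subfields": `rk E(F₅^{⟨σ⟩}) ≤ 1` for `σ ≠ 1` | the hypothesis `h` of the theorems below, written out | NOT formalised (six computer `2`-descents over cyclic quintic fields); no new named fact — the debt stays with the rank leaf `…_mordellWeilRank_480a1_F5`, to which `h` is equivalent |
| Galois descent `C₅ × C₅`: `rk E(F₅) = rk E(ℚ) + ∑_L (rk E(L) - rk E(ℚ)) = 1` | `DokchitserDokchitser2011.mordellWeilRank_baseChange_eq_one_of_exponent_prime` (`…CpCpProofs.lean`), `….F5.mordellWeilRank_curve480a1_eq_one_of_quintic` | proved |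
| converse `rk E(F₅^{⟨σ⟩}) ≤ rk E(F₅)` | `….F5.mordellWeilRank_curve480a1_quintic_le_one_of_eq_one` | proved |
| rank leaf, `n = 5` fact and the `n = 5` case of Thm. 2 from the quintic descents | `DokchitserDokchitser2011_mordellWeilRank_480a1_F5_of_quintic`, `…_iff_quintic`, `DokchitserDokchitser2011_rank_480a1_F5_of_quintic`, `not_isSumOfLocalInvariants_rankInvariant_zmod_five_of_quintic` | proved |

## The mathematics (as formalised)

`Gal(F₅/ℚ) ≅ Gal(K/ℚ) ⧸ H` with `H = galFifthPowers K`, the fifth powers of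
`Gal(K/ℚ) ≅ (ℤ/2651)ˣ` (Mathlib `IsGalois.normalAutEquivQuotient`; `H` is normal as `Gal(K/ℚ)` is
abelian), and `τ⁵ ∈ H` for every `τ` (`pow_five_mem_galFifthPowers`), so `σ⁵ = 1` for all
`σ ∈ Gal(F₅/ℚ)`; with `|Gal(F₅/ℚ)| = [F₅ : ℚ] = 25` this is `C₅ × C₅`, whose proper non-trivial
subgroups are the six `⟨σ⟩ ≅ C₅`, `σ ≠ 1`, so the minimal non-trivial subfields of `F₅` are the
fixed fields `F₅^{⟨σ⟩}`, of degree `25 / 5 = 5` (Artin: `[F₅ : F₅^{⟨σ⟩}] = |⟨σ⟩| = 5`).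
(Mathematically these are the quintic subfields of `ℚ(ζ₁₁)` and `ℚ(ζ₂₄₁)` and four cyclic quintic
fields of conductor `2651`; this identification is not formalised or used.) Let `M = E(F₅)`, a
finitely generated abelian group (Mordell–Weil, tree theorem
`WeierstrassCurve.module_finite_point_holds`) with `Gal(F₅/ℚ)` acting by transport of coordinates,
and `m₀ ∈ M` the image of `P = (-1, 2) ∈ E(ℚ)`, of infinite order
(`curve480a1.exists_nsmul_ne_zero`). A point fixed by `σ ≠ 1` lies in `E(F₅^{⟨σ⟩})`, where —
granted `rk E(F₅^{⟨σ⟩}) ≤ 1` — it is rationally dependent on `m₀`; the identity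
`20 = ∑_{σ ≠ 1} (1 + σ + ⋯ + σ⁴) - 4 ∑_σ σ` in `ℤ[C₅ × C₅]` then makes every `m ∈ M` rationally
dependent on `m₀`, i.e. `rk_ℤ M = 1` (`…CpCpProofs.lean`, `p = 5`).

## Design notes

* Theorems only: no definition and no named fact is introduced (D-0026). The quintic subfields are
  written `IntermediateField.fixedField (Subgroup.zpowers σ)` in place (for `σ = 1` this is `F₅`
  itself); the hypothesis quantifies over `σ ≠ 1`, i.e. over the six quintic subfields, each counted
  four times (`⟨σ⟩ = ⟨σ²⟩ = ⟨σ³⟩ = ⟨σ⁴⟩`) — exactly the "minimal non-trivial subfields" of the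
  source. It is stated with `WeierstrassCurve.mordellWeilRank` (`= Module.finrank ℤ E(·)`, honest by
  Mordell–Weil) and as the inequality `≤ 1` that a `2`-descent delivers (a `2`-Selmer rank bound);
  equality then follows (`rk E(ℚ) ≥ 1`).
* The group-theoretic lemmas are stated for any `2651`-st cyclotomic extension `K/ℚ` (as in the F5
  file); the last section specialises to `K = CyclotomicField 2651 ℚ`, the field of the rank leaf,
  under `set_option backward.isDefEq.respectTransparency false` (the `ℚ`-algebra instance diamond on
  `CyclotomicField`, crossed the same way in the F5 file).
* What is NOT here: the six `2`-descents themselves (`2`-Selmer groups of `480a1` over cyclic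
  quintic fields: integral bases, `S`-units and class groups of the `F₅^{⟨σ⟩}` for `S ∣ 30`, and the
  local images at the primes above `2`, `3`, `5` and at the five real places), for which Lean has no
  infrastructure yet (the tree has the Mordell–Weil theorem and a complete `2`-descent over `ℚ`,
  `Literature.NumberTheory.EllipticCurves.Curve24A1`, but no descent over a number field `≠ ℚ`).

## References

* T. Dokchitser, V. Dokchitser, *A note on the Mordell–Weil rank modulo `n`*, J. Number Theory 131
  (2011) 1833–1839, arXiv:0910.4588: proof of Thm. 2 (p. 3 of the held arXiv copy): "2-descent
  shows that `rk E/F₃ = rk E/F₅ = 1` and `rk E/F₄ = 6` (e.g. using Magma, over all minimal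
  non-trivial subfields of `F_n`)". [DokchitserDokchitser2011RankModN]
* J. H. Silverman, *The Arithmetic of Elliptic Curves*, 2nd ed., GTM 106 (2009), Thm. VIII.6.7
  (Mordell–Weil), Ch. X §1 (`2`-descent). [SilvermanAEC2009]
* J. Neukirch, *Algebraic Number Theory*, Grundlehren 322 (1999), Ch. IV §1 (Galois theory of
  `ℚ(ζₙ)/ℚ`). [NeukirchANT1999]
-/

noncomputable section

open scoped NumberField

open NumberField WeierstrassCurve IntermediateField

namespace Literature.Barriers.BirchSwinnertonDyer

namespace DokchitserDokchitser2011

variable (K : Type) [Field K] [NumberField K] [IsCyclotomicExtension {2651} ℚ K]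

/-- Fifth powers of `Gal(K/ℚ)` lie in `galFifthPowers K` (by definition: their images in
`(ℤ/2651)ˣ` are fifth powers). [folklore] -/
theorem pow_five_mem_galFifthPowers (τ : Gal(K/ℚ)) : τ ^ 5 ∈ galFifthPowers K := by
  rw [galFifthPowers, Subgroup.mem_comap, MonoidHom.mem_range]
  exact ⟨(IsCyclotomicExtension.Rat.galEquivZMod 2651 K).toMonoidHom τ, by
    rw [powMonoidHom_apply, map_pow]⟩

/-- **`Gal(F₅/ℚ)` has exponent `5`** (so, being of order `25`, it is `C₅ × C₅`): every
`σ ∈ Gal(F₅/ℚ) ≅ Gal(K/ℚ) ⧸ H`, `H` = the fifth powers (Mathlib `IsGalois.normalAutEquivQuotient`),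
is the restriction of some `τ`, and `τ⁵ ∈ H`. [folklore] -/
theorem F5.algEquiv_pow_five (σ : Gal((F5 K)/ℚ)) : σ ^ 5 = 1 := by
  haveI := IsCyclotomicExtension.isGalois {2651} ℚ K
  haveI := IsCyclotomicExtension.isAbelianGalois {2651} ℚ K
  haveI : (galFifthPowers K).Normal := inferInstance
  have key : ∀ q : Gal(K/ℚ) ⧸ galFifthPowers K, q ^ 5 = 1 := by
    intro q
    obtain ⟨τ, rfl⟩ := QuotientGroup.mk_surjective q
    rw [← QuotientGroup.mk_pow, QuotientGroup.eq_one_iff]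
    exact pow_five_mem_galFifthPowers K τ
  have key2 : ∀ q, IsGalois.normalAutEquivQuotient (galFifthPowers K) q ^ 5 = 1 := fun q => by
    rw [← map_pow, key, map_one]
  obtain ⟨q, hq⟩ := (IsGalois.normalAutEquivQuotient (galFifthPowers K)).surjective σ
  have h := key2 q
  rw [hq] at h
  exact h

/-- **`|Gal(F₅/ℚ)| = 25 = 5²`** (`F₅/ℚ` is Galois of degree `25`: `isGalois_F5`, `finrank_F5`).
[folklore] -/
theorem F5.card_aut : Nat.card Gal((F5 K)/ℚ) = 5 ^ 2 := by
  haveI := isGalois_F5 K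
  rw [IsGalois.card_aut_eq_finrank, finrank_F5]
  norm_num

/-- An element of `F₅` fixed by `σ ∈ Gal(F₅/ℚ)` lies in the fixed field `F₅^{⟨σ⟩}` of the cyclic
group `⟨σ⟩`. [folklore] -/
theorem F5.mem_fixedField_zpowers_of_apply_eq {σ : Gal((F5 K)/ℚ)} {x : F5 K} (hx : σ x = x) :
    x ∈ fixedField (Subgroup.zpowers σ) := by
  rw [mem_fixedField_iff]
  intro τ hτ
  have h : Subgroup.zpowers σ ≤ MulAction.stabilizer Gal((F5 K)/ℚ) x :=
    (Subgroup.zpowers_le (G := Gal((F5 K)/ℚ))).mpr (MulAction.mem_stabilizer_iff.mpr hx)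
  exact MulAction.mem_stabilizer_iff.mp (h hτ)

/-- **The fixed field `F₅^{⟨σ⟩}` of `σ ≠ 1` is a quintic field**: `σ` has order `5`
(`F5.algEquiv_pow_five`), so `[F₅ : F₅^{⟨σ⟩}] = |⟨σ⟩| = 5` (Artin, Mathlib
`IntermediateField.finrank_fixedField_eq_card`) and `[F₅^{⟨σ⟩} : ℚ] = 25 / 5 = 5`. These are the
six cyclic quintic subfields of `ℚ(ζ₂₆₅₁)` — each counted four times, `⟨σ⟩ = ⟨σ²⟩ = ⟨σ³⟩ = ⟨σ⁴⟩`
— i.e. "all minimal non-trivial subfields of `F₅`" of the source (conductors `11`, `241` and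
four of conductor `2651`; this identification is not formalised or used). [folklore] -/
theorem F5.finrank_fixedField_zpowers {σ : Gal((F5 K)/ℚ)} (hσ : σ ≠ 1) :
    Module.finrank ℚ (fixedField (Subgroup.zpowers σ)) = 5 := by
  haveI : Fact (Nat.Prime 5) := ⟨Nat.prime_five⟩
  have h5 : Module.finrank (fixedField (Subgroup.zpowers σ)) (F5 K) = 5 := by
    rw [finrank_fixedField_eq_card, Nat.card_zpowers, orderOf_eq_prime (F5.algEquiv_pow_five K σ) hσ]
  have h := Module.finrank_mul_finrank ℚ (fixedField (Subgroup.zpowers σ)) (F5 K)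
  rw [h5, finrank_F5] at h
  omega

/-- **`rk E(F₅) = 1` from the six quintic `2`-descents** (proof of Theorem 2 of
Dokchitser–Dokchitser 2011, `n = 5`, as printed: "2-descent shows that `rk E/F₅ = 1` (e.g. using
Magma, over all minimal non-trivial subfields of `F_n`)"): `Gal(F₅/ℚ)` has order `25`
(`F5.card_aut`) and exponent `5` (`F5.algEquiv_pow_five`); `P = (-1, 2) ∈ E(ℚ)` has infinite order
(`curve480a1.exists_nsmul_ne_zero`); a point of `E(F₅)` fixed by `σ ≠ 1` is defined over the
quintic field `F₅^{⟨σ⟩}` (`F5.mem_fixedField_zpowers_of_apply_eq`), where `rk E(F₅^{⟨σ⟩}) ≤ 1` (the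
hypothesis: the six quintic `2`-descent bounds); hence `rk E(F₅) = 1` by the `C₅ × C₅` Galois descent
`mordellWeilRank_baseChange_eq_one_of_exponent_prime` (`…CpCpProofs.lean`).
[cite: DokchitserDokchitser2011RankModN, proof of Thm. 2] -/
theorem F5.mordellWeilRank_curve480a1_eq_one_of_quintic
    (h : ∀ σ : Gal((F5 K)/ℚ), σ ≠ 1 →
      (curve480a1.baseChange (fixedField (Subgroup.zpowers σ))).mordellWeilRank ≤ 1) :
    (curve480a1.baseChange (F5 K)).mordellWeilRank = 1 :=
  mordellWeilRank_baseChange_eq_one_of_exponent_prime (F := F5 K) curve480a1 Nat.prime_five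
    (F5.card_aut K) (F5.algEquiv_pow_five K) curve480a1.exists_nsmul_ne_zero
    fun σ hσ => ⟨fixedField (Subgroup.zpowers σ), inferInstance, inferInstance, inferInstance,
      (fixedField (Subgroup.zpowers σ)).val,
      fun x hx => ⟨⟨x, F5.mem_fixedField_zpowers_of_apply_eq K hx⟩, rfl⟩, h σ hσ⟩

/-- **Converse**: `rk E(F₅) = 1` gives back the six quintic bounds, since `rk E(F₅^{⟨σ⟩}) ≤ rk E(F₅)`
along the inclusion (`mordellWeilRank_baseChange_le_of_algHom`). [folklore] -/
theorem F5.mordellWeilRank_curve480a1_quintic_le_one_of_eq_one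
    (h : (curve480a1.baseChange (F5 K)).mordellWeilRank = 1) (σ : Gal((F5 K)/ℚ)) :
    (curve480a1.baseChange (fixedField (Subgroup.zpowers σ))).mordellWeilRank ≤ 1 :=
  (mordellWeilRank_baseChange_le_of_algHom (F := F5 K) curve480a1
    (fixedField (Subgroup.zpowers σ)).val).trans h.le

end DokchitserDokchitser2011

open DokchitserDokchitser2011

/-! ### The `n = 5` leaf, fact and barrier from the six quintic `2`-descents -/

set_option backward.isDefEq.respectTransparency false in
/-- **The rank leaf `rk E(F₅) = 1` from the six quintic `2`-descents** (proof of Theorem 2 of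
Dokchitser–Dokchitser 2011, `n = 5`: "2-descent shows that `rk E/F₅ = 1` (e.g. using Magma, over all
minimal non-trivial subfields of `F_n`)"): the tree's named fact
`DokchitserDokchitser2011_mordellWeilRank_480a1_F5` — `rk_ℤ E(F₅) = 1` for `E = 480a1` and
`F₅ = DokchitserDokchitser2011.F5 (CyclotomicField 2651 ℚ)` — follows from the `2`-descent bounds
`rk_ℤ E(F₅^{⟨σ⟩}) ≤ 1` over the six quintic subfields `F₅^{⟨σ⟩}`, `σ ≠ 1`
(`F5.mordellWeilRank_curve480a1_eq_one_of_quintic`; all other inputs — `C₅ × C₅`, the point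
`(-1, 2)` of infinite order, Mordell–Weil — are theorems of the tree).
[cite: DokchitserDokchitser2011RankModN, proof of Thm. 2] -/
theorem DokchitserDokchitser2011_mordellWeilRank_480a1_F5_of_quintic
    (h : ∀ σ : Gal((F5 (CyclotomicField 2651 ℚ))/ℚ), σ ≠ 1 →
      (curve480a1.baseChange (fixedField (Subgroup.zpowers σ))).mordellWeilRank ≤ 1) :
    DokchitserDokchitser2011_mordellWeilRank_480a1_F5 :=
  F5.mordellWeilRank_curve480a1_eq_one_of_quintic (CyclotomicField 2651 ℚ) h

set_option backward.isDefEq.respectTransparency false in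
/-- **The rank leaf is equivalent to the six quintic `2`-descents**: `rk E(F₅) = 1` iff
`rk E(F₅^{⟨σ⟩}) ≤ 1` for all `σ ≠ 1` (the quintic bounds are implied back by
`rk E(F₅^{⟨σ⟩}) ≤ rk E(F₅)`), so the hypothesis of this file asserts nothing beyond the named fact
`DokchitserDokchitser2011_mordellWeilRank_480a1_F5`. [cite: DokchitserDokchitser2011RankModN, proof of Thm. 2] -/
theorem DokchitserDokchitser2011_mordellWeilRank_480a1_F5_iff_quintic :
    DokchitserDokchitser2011_mordellWeilRank_480a1_F5 ↔
      ∀ σ : Gal((F5 (CyclotomicField 2651 ℚ))/ℚ), σ ≠ 1 →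
        (curve480a1.baseChange (fixedField (Subgroup.zpowers σ))).mordellWeilRank ≤ 1 :=
  ⟨fun h σ _ => F5.mordellWeilRank_curve480a1_quintic_le_one_of_eq_one (CyclotomicField 2651 ℚ) h σ,
    DokchitserDokchitser2011_mordellWeilRank_480a1_F5_of_quintic⟩

set_option backward.isDefEq.respectTransparency false in
/-- **The `n = 5` witness of Theorem 2 from the six quintic `2`-descents**: the tree's named fact
`DokchitserDokchitser2011_rank_480a1_F5` (the field `F₅`, its splitting, `rk E(F₅) = 1`) follows
from the quintic bounds alone (through `DokchitserDokchitser2011_rank_480a1_F5_of_mordellWeilRank` of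
the F5 file, all of whose field-theoretic inputs are theorems).
[cite: DokchitserDokchitser2011RankModN, proof of Thm. 2] -/
theorem DokchitserDokchitser2011_rank_480a1_F5_of_quintic
    (h : ∀ σ : Gal((F5 (CyclotomicField 2651 ℚ))/ℚ), σ ≠ 1 →
      (curve480a1.baseChange (fixedField (Subgroup.zpowers σ))).mordellWeilRank ≤ 1) :
    DokchitserDokchitser2011_rank_480a1_F5 :=
  DokchitserDokchitser2011_rank_480a1_F5_of_mordellWeilRank
    (DokchitserDokchitser2011_mordellWeilRank_480a1_F5_of_quintic h)

set_option backward.isDefEq.respectTransparency false in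
/-- **The Mordell–Weil rank modulo `5` is not a sum of local invariants, from the six quintic
`2`-descents** (the `n = 5` case of Theorem 2 of Dokchitser–Dokchitser 2011, with its Magma
computations over the minimal non-trivial subfields of `F₅` as the only hypothesis).
[cite: DokchitserDokchitser2011RankModN, Thm. 2 (proof)] -/
theorem not_isSumOfLocalInvariants_rankInvariant_zmod_five_of_quintic
    (h : ∀ σ : Gal((F5 (CyclotomicField 2651 ℚ))/ℚ), σ ≠ 1 →
      (curve480a1.baseChange (fixedField (Subgroup.zpowers σ))).mordellWeilRank ≤ 1) :
    ¬ IsSumOfLocalInvariants (rankInvariant (ZMod 5)) :=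
  not_isSumOfLocalInvariants_rankInvariant_zmod_five
    (DokchitserDokchitser2011_mordellWeilRank_480a1_F5_of_quintic h)

end Literature.Barriers.BirchSwinnertonDyer

end
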